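import Literature.Topology.FourManifolds.LefschetzHandlebody
import Literature.Topology.FourManifolds.TwoHandleTubeCoordinates
import Literature.Topology.FourManifolds.FishtailCapEndPoints
import Literature.AlgebraicTopology.FundamentalGroup.CellAttachmentKernelLoop
import Summits.SmoothPoincare4.SmoothPoincare4.Theorems.ConvexBisectionAcyclicBisectionExistsMultiAttachmentHomologyLoops
import Summits.SmoothPoincare4.SmoothPoincare4.Theorems.ConvexBisectionAcyclicBisectionExistsMultiAttachmentH1Model
import Summits.SmoothPoincare4.SmoothPoincare4.Theorems.ConvexBisectionAcyclicBisectionExistsKasSeamCover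
import HarnessLib

/-!
# The sphere off the core `S³ ∖ S ≅ D² × S¹`: path connected, `H₁` generated by the meridian (of
# infinite order), the longitude bounds
(helper for stub `stub_modelsOn_counts` = NF2, clause 3 = Kas' presentation of `H₁(∂X(F; l); ℤ)`;
line `modp-braid-orbits` r9, crux `ConvexBisection.AcyclicBisectionExists`, item
stmt-SmoothPoincare4-10508; wave 4 / W4-D, design lemma (D-sphere) `Kas_sphereOffCore_homology` of
`work/stubs/Kas_Design.lean`, plus the generation statement needed by (D).)

`sphereOffCore = {x ∈ S³ : |x_λ| < 1}` (`…KasSeamCover.lean`) deformation retracts onto the BELT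
CIRCLE `β = {x_λ = 0}`: the deformation `G_t(x_λ, x_μ) = (√(1−t) x_λ, √(1 − (1−t)|x_λ|²) x_μ/|x_μ|)`
(§1, `beltHomotopy : id ≃ belt ∘ ang`, with `ang x = x_μ/|x_μ| ∈ 𝕊¹` and `belt φ = (0, φ)`).  Hence
(§2) every class of `H₁(S³ ∖ S; ℤ)` comes from `H₁(𝕊¹)`, which the simple closed curve `circlePt`
generates (`zpowers_liftPath_eq_top_of_simpleClosed`, Hatcher Thm. 1.7, and Hurewicz
`range_map_one_eq_span`): **`Kas_sphereOffCore_generated`** — every class is a multiple of the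
class of the model MERIDIAN `φ ↦ (θ₀, φ)/√2` (homotopic to `belt` through `G`); the model LONGITUDE
`θ ↦ (θ, θ₀)/√2` is carried by `G₁` to the constant loop, so its class VANISHES; and the meridian
class has INFINITE ORDER, detected by the winding functional of `x ↦ x_μ ∈ ℂ ∖ 0`
(`loopClass_windingLoop_smul_injective`).  §3: **`Kas_sphereOffCore_homology`** (the design
statement, = registered sub-goal stub `stub_Kas_sphereOffCore_homology`).

Everything is proved; no named facts, no `sorry`.  References: A. Kas, Pacific J. Math. 89 (1980)
[Kas1980]; R. E. Gompf, A. I. Stipsicz, *4-Manifolds and Kirby Calculus* (1999), §8.2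
[GompfStipsicz1999]; A. Hatcher, *Algebraic Topology* (2002), Thm. 1.7, Thm. 2A.1 [HatcherAT2002].
-/

noncomputable section

-- the prescribed namespace `Summit.<P>.<Sub>.…` duplicates `SmoothPoincare4` (P = Sub)
set_option linter.dupNamespace false

open scoped Manifold ContDiff Topology unitInterval
open Set Function Metric CategoryTheory
open Literature.Topology.FourManifolds Literature.Topology.FourManifolds.LefschetzBase
  Literature.AlgebraicTopology.SingularHomology Literature.Topology.FourManifolds.HandleAttachingMap
  Literature.AlgebraicTopology.FundamentalGroup Literature.AlgebraicTopology.FundamentalGroup.VanKampen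

namespace Summit.SmoothPoincare4.SmoothPoincare4.Theorems.AcyclicBisectionExists.ModpBraidOrbits

/-! ## §1 Coordinates, the belt circle, the angle, the deformation -/

section Deformation

/-- The vector of `ℝ⁴` underlying a point of the sphere off the core. [folklore] -/
def vecS (b : ↥sphereOffCore) : EuclideanSpace ℝ (Fin 4) :=
  (((b : ↥(beltPiece 3 2)) : closedBall (0 : EuclideanSpace ℝ (Fin 4)) 1) : EuclideanSpace ℝ (Fin 4))

/-- `vecS` is continuous. [folklore] -/
theorem continuous_vecS : Continuous vecS :=
  continuous_subtype_val.comp (continuous_subtype_val.comp continuous_subtype_val)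

/-- `‖x‖ = 1` on the sphere off the core. [folklore] -/
theorem norm_vecS (b : ↥sphereOffCore) : ‖vecS b‖ = 1 := b.2

/-- `|x_λ|² < 1` on the sphere off the core. [folklore] -/
theorem lamSq_vecS_lt_one (b : ↥sphereOffCore) : lamSq 2 (vecS b) < 1 :=
  lt_of_le_of_ne (lamSq_le_one (norm_vecS b).le) (b : ↥(beltPiece 3 2)).2

/-- `‖x_λ‖² + ‖x_μ‖² = 1` on the sphere off the core. [folklore] -/
theorem norm_lam_sq_add_norm_mu_sq (b : ↥sphereOffCore) :
    ‖lamPart₂ 2 (vecS b)‖ ^ 2 + ‖muPartG 2 (vecS b)‖ ^ 2 = 1 := by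
  rw [← norm_sq_eq_lamPart₂_muPartG, norm_vecS, one_pow]

/-- `‖x_λ‖² < 1` on the sphere off the core. [folklore] -/
theorem norm_lam_sq_lt_one (b : ↥sphereOffCore) : ‖lamPart₂ 2 (vecS b)‖ ^ 2 < 1 := by
  rw [← lamSq_two_eq]; exact lamSq_vecS_lt_one b

/-- `‖x_μ‖ > 0` on the sphere off the core. [folklore] -/
theorem norm_mu_pos (b : ↥sphereOffCore) : 0 < ‖muPartG 2 (vecS b)‖ := by
  have h1 := norm_lam_sq_add_norm_mu_sq b
  have h2 := norm_lam_sq_lt_one b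
  have h3 : 0 < ‖muPartG 2 (vecS b)‖ ^ 2 := by linarith
  exact lt_of_le_of_ne (norm_nonneg _) fun h => by rw [← h] at h3; norm_num at h3

/-- **A point of the sphere off the core from a vector** `u ⊕ v` with `‖u‖² + ‖v‖² = 1`, `‖u‖² < 1`.
[folklore] -/
def mkS (u v : EuclideanSpace ℝ (Fin 2)) (h1 : ‖u‖ ^ 2 + ‖v‖ ^ 2 = 1) (hu : ‖u‖ ^ 2 < 1) :
    ↥sphereOffCore :=
  have hn : ‖lamEmbed₂ 2 u + muEmbedG 2 v‖ = 1 := by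
    have h := norm_lamEmbed₂_add_muEmbedG_sq (m := 2) u v
    rw [h1] at h
    nlinarith [norm_nonneg (lamEmbed₂ 2 u + muEmbedG 2 v)]
  ⟨⟨⟨lamEmbed₂ 2 u + muEmbedG 2 v, mem_closedBall_zero_iff.2 hn.le⟩, by
    rw [mem_beltPiece]
    show lamSq 2 (lamEmbed₂ 2 u + muEmbedG 2 v) ≠ 1
    rw [lamSq_two_eq, map_add, lamPart₂_lamEmbed₂, lamPart₂_muEmbedG, add_zero]
    exact hu.ne⟩, hn⟩

/-- The vector of `mkS u v`. [folklore] -/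
@[simp] theorem vecS_mkS (u v : EuclideanSpace ℝ (Fin 2)) (h1 : ‖u‖ ^ 2 + ‖v‖ ^ 2 = 1)
    (hu : ‖u‖ ^ 2 < 1) : vecS (mkS u v h1 hu) = lamEmbed₂ 2 u + muEmbedG 2 v := rfl

/-- Points of the sphere off the core with the same vector are equal. [folklore] -/
theorem ext_vecS {b b' : ↥sphereOffCore} (h : vecS b = vecS b') : b = b' :=
  Subtype.ext (Subtype.ext (Subtype.ext h))

/-- **The belt circle** `φ ↦ (0, φ)` of the sphere off the core. [cite: GompfStipsicz1999, §8.2] -/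
def belt : C(sphere (0 : EuclideanSpace ℝ (Fin 2)) 1, ↥sphereOffCore) where
  toFun φ := mkS 0 φ (by rw [norm_zero, norm_eq_of_mem_sphere φ]; norm_num) (by rw [norm_zero]; norm_num)
  continuous_toFun := by
    refine Continuous.subtype_mk (Continuous.subtype_mk (Continuous.subtype_mk ?_ _) _) _
    exact ((lamEmbed₂ 2).continuous.comp continuous_const).add
      ((muEmbedG 2).continuous.comp continuous_subtype_val)

/-- **The angle** `x ↦ x_μ/|x_μ| ∈ 𝕊¹` of the sphere off the core. [cite: GompfStipsicz1999, §8.2] -/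
def ang : C(↥sphereOffCore, sphere (0 : EuclideanSpace ℝ (Fin 2)) 1) where
  toFun b := ⟨‖muPartG 2 (vecS b)‖⁻¹ • muPartG 2 (vecS b), by
    rw [mem_sphere_zero_iff_norm, norm_smul, norm_inv, norm_norm,
      inv_mul_cancel₀ (norm_mu_pos b).ne']⟩
  continuous_toFun := by
    refine Continuous.subtype_mk ?_ _
    have hq : Continuous fun b => muPartG 2 (vecS b) := (muPartG 2).continuous.comp continuous_vecS
    exact (hq.norm.inv₀ fun b => (norm_mu_pos b).ne').smul hq

/-- The `λ`-part `√(1−t) x_λ` of the deformation. [folklore] -/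
def defLam (t : ℝ) (b : ↥sphereOffCore) : EuclideanSpace ℝ (Fin 2) :=
  Real.sqrt (1 - t) • lamPart₂ 2 (vecS b)

/-- The `μ`-part `√(1 − (1−t)‖x_λ‖²) x_μ/‖x_μ‖` of the deformation. [folklore] -/
def defMu (t : ℝ) (b : ↥sphereOffCore) : EuclideanSpace ℝ (Fin 2) :=
  (Real.sqrt (1 - (1 - t) * ‖lamPart₂ 2 (vecS b)‖ ^ 2) / ‖muPartG 2 (vecS b)‖) • muPartG 2 (vecS b)

/-- The two parts of the deformation have squared norms `(1−t)‖x_λ‖²`, `1 − (1−t)‖x_λ‖²`.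
[folklore] -/
theorem norm_defVec_parts {t : ℝ} (ht0 : 0 ≤ t) (ht1 : t ≤ 1) (b : ↥sphereOffCore) :
    ‖defLam t b‖ ^ 2 = (1 - t) * ‖lamPart₂ 2 (vecS b)‖ ^ 2 ∧
    ‖defMu t b‖ ^ 2 = 1 - (1 - t) * ‖lamPart₂ 2 (vecS b)‖ ^ 2 := by
  have hq := norm_mu_pos b
  have hp := norm_lam_sq_lt_one b
  have hpt : 0 ≤ 1 - (1 - t) * ‖lamPart₂ 2 (vecS b)‖ ^ 2 := by
    nlinarith [norm_nonneg (lamPart₂ 2 (vecS b))]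
  constructor
  · rw [defLam, norm_smul, Real.norm_eq_abs, abs_of_nonneg (Real.sqrt_nonneg _), mul_pow,
      Real.sq_sqrt (by linarith)]
  · rw [defMu, norm_smul, norm_div, Real.norm_eq_abs, abs_of_nonneg (Real.sqrt_nonneg _), norm_norm,
      div_mul_cancel₀ _ hq.ne', Real.sq_sqrt hpt]

/-- **The deformed point** `G_t(x)` of the sphere off the core. [folklore] -/
def defPt (t : I) (b : ↥sphereOffCore) : ↥sphereOffCore :=
  mkS (defLam t b) (defMu t b)
    (by rw [(norm_defVec_parts t.2.1 t.2.2 b).1, (norm_defVec_parts t.2.1 t.2.2 b).2]; ring)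
    (by
      rw [(norm_defVec_parts t.2.1 t.2.2 b).1]
      have hp := norm_lam_sq_lt_one b
      nlinarith [norm_nonneg (lamPart₂ 2 (vecS b)), t.2.1, t.2.2])

/-- The vector of the deformed point. [folklore] -/
theorem vecS_defPt (t : I) (b : ↥sphereOffCore) :
    vecS (defPt t b) = lamEmbed₂ 2 (defLam t b) + muEmbedG 2 (defMu t b) := rfl

/-- **The deformation of the sphere off the core onto the belt circle**, as a homotopy from the
identity to `belt ∘ ang`. [cite: GompfStipsicz1999, §8.2] -/
def beltHomotopy : (ContinuousMap.id ↥sphereOffCore).Homotopy (belt.comp ang) where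
  toFun p := defPt p.1 p.2
  continuous_toFun := by
    refine Continuous.subtype_mk (Continuous.subtype_mk (Continuous.subtype_mk ?_ _) _) _
    show Continuous fun p : I × ↥sphereOffCore =>
      lamEmbed₂ 2 (defLam (p.1 : ℝ) p.2) + muEmbedG 2 (defMu (p.1 : ℝ) p.2)
    unfold defLam defMu
    have ht : Continuous fun p : I × ↥sphereOffCore => ((p.1 : I) : ℝ) :=
      continuous_subtype_val.comp continuous_fst
    have hp : Continuous fun p : I × ↥sphereOffCore => lamPart₂ 2 (vecS p.2) :=
      (lamPart₂ 2).continuous.comp (continuous_vecS.comp continuous_snd)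
    have hq : Continuous fun p : I × ↥sphereOffCore => muPartG 2 (vecS p.2) :=
      (muPartG 2).continuous.comp (continuous_vecS.comp continuous_snd)
    have hc : Continuous fun p : I × ↥sphereOffCore =>
        Real.sqrt (1 - (1 - (p.1 : ℝ)) * ‖lamPart₂ 2 (vecS p.2)‖ ^ 2) / ‖muPartG 2 (vecS p.2)‖ :=
      ((continuous_const.sub ((continuous_const.sub ht).mul (hp.norm.pow 2))).sqrt).div
        hq.norm fun p => (norm_mu_pos p.2).ne'
    exact ((lamEmbed₂ 2).continuous.comp (((continuous_const.sub ht).sqrt).smul hp)).add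
      ((muEmbedG 2).continuous.comp (hc.smul hq))
  map_zero_left b := by
    apply ext_vecS
    rw [vecS_defPt]
    show lamEmbed₂ 2 (defLam 0 b) + muEmbedG 2 (defMu 0 b) = vecS b
    have hq := norm_mu_pos b
    have hq2 : ‖muPartG 2 (vecS b)‖ ^ 2 = 1 - ‖lamPart₂ 2 (vecS b)‖ ^ 2 := by
      linarith [norm_lam_sq_add_norm_mu_sq b]
    rw [defLam, defMu, sub_zero, Real.sqrt_one, one_smul, one_mul, ← hq2, Real.sqrt_sq hq.le,
      div_self hq.ne', one_smul, lamEmbed₂_lamPart₂_add_muEmbedG_muPartG]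
  map_one_left b := by
    apply ext_vecS
    rw [vecS_defPt]
    show lamEmbed₂ 2 (defLam 1 b) + muEmbedG 2 (defMu 1 b) =
      lamEmbed₂ 2 0 + muEmbedG 2 (‖muPartG 2 (vecS b)‖⁻¹ • muPartG 2 (vecS b))
    rw [defLam, defMu, sub_self, Real.sqrt_zero, zero_smul, zero_mul, sub_zero, Real.sqrt_one, one_div]

end Deformation

/-! ## §2 Homology: generated by the meridian, the longitude bounds, infinite order -/

section Homology

/-- On `H₁` the deformation end `belt ∘ ang` acts as the identity. [cite: HatcherAT2002, Thm. 2.10] -/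
theorem map_belt_comp_ang_apply (y : singularHomology ℤ ℤ ↥sphereOffCore 1) :
    singularHomology.map ℤ ℤ belt 1 (singularHomology.map ℤ ℤ ang 1 y) = y := by
  rw [← ModuleCat.comp_apply, ← singularHomology.map_comp,
    ← singularHomology.map_eq_of_homotopic ℤ ℤ ⟨beltHomotopy⟩, singularHomology.map_id]
  rfl

/-- The `μ`-part of a Clifford vector is `φ/√2`. [folklore] -/
theorem muPartG_cliffordVec (θ φ : sphere (0 : EuclideanSpace ℝ (Fin 2)) 1) :
    muPartG 2 (cliffordVec θ φ) = (Real.sqrt 2)⁻¹ • (φ : EuclideanSpace ℝ (Fin 2)) := by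
  ext j
  fin_cases j <;> simp [cliffordVec, muPartG_apply, div_eq_inv_mul]

/-- **The angle of a Clifford point is its second angle**: `ang ((θ, φ)/√2) = φ`. [folklore] -/
theorem ang_toSphere_cliffordPt (θ φ : sphere (0 : EuclideanSpace ℝ (Fin 2)) 1) :
    ang (tubeSeamToSphereOffCore ⟨cliffordPt θ φ, cliffordPt_mem_tubeSeam θ φ⟩) = φ := by
  apply Subtype.ext
  show ‖muPartG 2 (cliffordVec θ φ)‖⁻¹ • muPartG 2 (cliffordVec θ φ) = (φ : EuclideanSpace ℝ (Fin 2))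
  have hs : (0 : ℝ) < (Real.sqrt 2)⁻¹ := inv_pos.2 (Real.sqrt_pos.2 (by norm_num))
  rw [muPartG_cliffordVec, norm_smul, Real.norm_eq_abs, abs_of_pos hs, norm_eq_of_mem_sphere φ,
    mul_one, smul_smul, inv_mul_cancel₀ hs.ne', one_smul]

/-- The standard loop `t ↦ e^{2πit}` of the circle. [folklore] -/
abbrev circleLoop : Path (circlePt 0) (circlePt 0) :=
  loopPath (id : sphere (0 : EuclideanSpace ℝ (Fin 2)) 1 → _) continuous_id

/-- **Every class of `H₁(S³ ∖ S; ℤ)` is a multiple of the belt class.** [cite: HatcherAT2002, Thm. 1.7] -/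
theorem exists_eq_zsmul_belt (y : singularHomology ℤ ℤ ↥sphereOffCore 1) :
    ∃ a : ℤ, y = a • loopClass ℤ ℤ (1 : ℤ) (circleLoop.map belt.continuous) := by
  -- `π₁(𝕊¹)` is generated by the standard loop
  have hgen := zpowers_liftPath_eq_top_of_simpleClosed circleLoop circlePt_eq_iff
    (S := (univ : Set (sphere (0 : EuclideanSpace ℝ (Fin 2)) 1))) (fun _ => mem_univ _)
    (fun θ _ => by obtain ⟨t, rfl⟩ := exists_circlePt_eq θ; exact ⟨t, rfl⟩) (mem_univ _)
  haveI : PathConnectedSpace (sphere (0 : EuclideanSpace ℝ (Fin 2)) 1) := by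
    refine isPathConnected_iff_pathConnectedSpace.mp (isPathConnected_sphere ?_ _ zero_le_one)
    rw [← Module.finrank_eq_rank, finrank_euclideanSpace_fin]
    norm_num
  haveI : PathConnectedSpace ↥(univ : Set (sphere (0 : EuclideanSpace ℝ (Fin 2)) 1)) :=
    (Homeomorph.Set.univ _).symm.surjective.pathConnectedSpace (Homeomorph.Set.univ _).symm.continuous
  have hL : ∀ γ : Path (⟨circlePt 0, mem_univ _⟩ : ↥(univ : Set (sphere (0 : EuclideanSpace ℝ (Fin 2)) 1)))
      ⟨circlePt 0, mem_univ _⟩, ∃ n : ℤ, FundamentalGroup.fromPath (Path.Homotopic.Quotient.mk γ) =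
      FundamentalGroup.fromPath (Path.Homotopic.Quotient.mk
        (liftPath univ circleLoop fun _ => mem_univ _)) ^ n := by
    intro γ
    have hm : FundamentalGroup.fromPath (Path.Homotopic.Quotient.mk γ) ∈ Subgroup.zpowers
        (FundamentalGroup.fromPath (Path.Homotopic.Quotient.mk
          (liftPath univ circleLoop fun _ => mem_univ _))) := by
      rw [hgen]; exact Subgroup.mem_top _
    obtain ⟨n, hn⟩ := Subgroup.mem_zpowers_iff.1 hm
    exact ⟨n, hn.symm⟩
  -- `H₁(univ) → H₁(sphereOffCore)` along `belt ∘ val` has range the span of the belt class …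
  let uval : C(↥(univ : Set (sphere (0 : EuclideanSpace ℝ (Fin 2)) 1)),
      sphere (0 : EuclideanSpace ℝ (Fin 2)) 1) := ⟨Subtype.val, continuous_subtype_val⟩
  have hr := range_map_one_eq_span ℤ _ hL (belt.comp uval)
  -- … and is onto: `y = belt_* (ang_* y)` and `val_*` is onto
  have hy : y ∈ LinearMap.range (singularHomology.map ℤ ℤ (belt.comp uval) 1).hom := by
    have hs : Function.Surjective (singularHomology.map ℤ ℤ uval 1) := by
      rw [show uval = (Homeomorph.Set.univ (sphere (0 : EuclideanSpace ℝ (Fin 2)) 1) : C(_, _))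
        from rfl, ← singularHomology.mapIso_hom]
      exact ((ConcreteCategory.isIso_iff_bijective _).1 inferInstance).2
    obtain ⟨z, hz⟩ := hs (singularHomology.map ℤ ℤ ang 1 y)
    refine ⟨z, ?_⟩
    show (singularHomology.map ℤ ℤ (belt.comp uval) 1) z = y
    rw [singularHomology.map_comp, ModuleCat.comp_apply, hz, map_belt_comp_ang_apply]
  rw [hr] at hy
  obtain ⟨a, ha⟩ := Submodule.mem_span_singleton.1 hy
  refine ⟨a, ?_⟩
  rw [← ha]
  exact int_smul_eq_zsmul _ a _

/-- **The model meridian has the belt class**: `[toSphere ∘ modelMer] = [belt ∘ circlePt]`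
(`belt ∘ ang ≃ id` and `ang` of the meridian point `(θ₀, φ)/√2` is `φ`). [cite: GompfStipsicz1999, §8.2] -/
theorem loopClass_modelMer_eq_belt :
    singularHomology.map ℤ ℤ toSphereC 1 (loopClass ℤ ℤ (1 : ℤ) (loopPath modelMer continuous_modelMer)) =
      loopClass ℤ ℤ (1 : ℤ) (circleLoop.map belt.continuous) := by
  rw [← map_belt_comp_ang_apply (singularHomology.map ℤ ℤ toSphereC 1 _), map_loopClass,
    map_loopClass, map_loopClass]
  refine loopClass_eq_of_coe_eq ℤ _ _ (funext fun t => ?_)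
  show belt (ang (tubeSeamToSphereOffCore (modelMer (circlePt t)))) = belt (circlePt t)
  rw [modelMer, ang_toSphere_cliffordPt]

/-- **(S4) Every class of `H₁(S³ ∖ S; ℤ)` is a multiple of the meridian class.**
[cite: GompfStipsicz1999, §8.2] -/
theorem Kas_sphereOffCore_generated (c : singularHomology ℤ ℤ ↥sphereOffCore 1) : ∃ a : ℤ,
    c = a • singularHomology.map ℤ ℤ toSphereC 1
      (loopClass ℤ ℤ (1 : ℤ) (loopPath modelMer continuous_modelMer)) := by
  rw [loopClass_modelMer_eq_belt]; exact exists_eq_zsmul_belt c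

/-- **(S2) The model longitude bounds in `S³ ∖ S`**: its class vanishes (`G₁` carries it to the
constant loop at `(0, θ₀)`). [cite: GompfStipsicz1999, §8.2] -/
theorem map_loopClass_modelLong_eq_zero :
    singularHomology.map ℤ ℤ toSphereC 1 (loopClass ℤ ℤ (1 : ℤ) (loopPath modelLong continuous_modelLong)) = 0 := by
  rw [← map_belt_comp_ang_apply (singularHomology.map ℤ ℤ toSphereC 1 _), map_loopClass,
    map_loopClass, map_loopClass, ← loopClass_refl ℤ ℤ (1 : ℤ) (belt baseAngle)]
  refine loopClass_eq_of_coe_eq ℤ _ _ (funext fun t => ?_)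
  show belt (ang (tubeSeamToSphereOffCore (modelLong (circlePt t)))) = belt baseAngle
  rw [modelLong, ang_toSphere_cliffordPt]

/-- **The `μ`-coordinate functional** `x ↦ x_μ ∈ ℂ ∖ 0` on the sphere off the core. [folklore] -/
def muC : C(↥sphereOffCore, PuncturedPlane.CStar) where
  toFun b := ⟨toC (muPartG 2 (vecS b)), by
    rw [← norm_pos_iff, norm_toC]; exact norm_mu_pos b⟩
  continuous_toFun := by
    refine Continuous.subtype_mk ?_ _
    exact contDiff_toC.continuous.comp ((muPartG 2).continuous.comp continuous_vecS)

/-- **The meridian read through `x_μ` is the winding loop of radius `1/√2`.** [folklore] -/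
theorem map_muC_loopClass_modelMer :
    singularHomology.map ℤ ℤ muC 1 (singularHomology.map ℤ ℤ toSphereC 1
      (loopClass ℤ ℤ (1 : ℤ) (loopPath modelMer continuous_modelMer))) =
      loopClass ℤ ℤ (1 : ℤ) (PuncturedPlane.windingLoop (Real.sqrt 2)⁻¹
        (inv_pos.2 (Real.sqrt_pos.2 (by norm_num))) 1) := by
  rw [map_loopClass, map_loopClass]
  refine loopClass_eq_of_coe_eq ℤ _ _ (funext fun t => Subtype.ext ?_)
  rw [Path.map_coe, Path.map_coe, Function.comp_apply, Function.comp_apply,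
    PuncturedPlane.windingLoop_apply_coe]
  show toC (muPartG 2 (cliffordVec baseAngle (circlePt t))) = _
  rw [muPartG_cliffordVec, toC_smul, toC_circlePt, Circle.coe_exp]
  push_cast
  ring_nf

/-- **(S3) The meridian class has infinite order in `H₁(S³ ∖ S; ℤ)`.** [cite: HatcherAT2002, Thm. 1.7] -/
theorem eq_zero_of_zsmul_modelMer_eq_zero (a : ℤ) (ha : a • singularHomology.map ℤ ℤ toSphereC 1
    (loopClass ℤ ℤ (1 : ℤ) (loopPath modelMer continuous_modelMer)) = 0) : a = 0 := by
  have h := congrArg (singularHomology.map ℤ ℤ muC 1) ha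
  rw [map_zsmul, map_zero, map_muC_loopClass_modelMer] at h
  have h0 := loopClass_windingLoop_smul_injective (Real.sqrt 2)⁻¹
    (inv_pos.2 (Real.sqrt_pos.2 (by norm_num))) (a₁ := a) (a₂ := 0) (by simpa using h)
  exact h0

/-- **(S1) The sphere off the core is path connected** (every point is deformed onto the belt circle,
an image of the path-connected circle). [folklore] -/
theorem isPathConnected_sphereOffCore : IsPathConnected (sphereOffCore : Set ↥(beltPiece 3 2)) := by
  haveI : PathConnectedSpace (sphere (0 : EuclideanSpace ℝ (Fin 2)) 1) := by
    refine isPathConnected_iff_pathConnectedSpace.mp (isPathConnected_sphere ?_ _ zero_le_one)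
    rw [← Module.finrank_eq_rank, finrank_euclideanSpace_fin]
    norm_num
  rw [isPathConnected_iff_pathConnectedSpace]
  have key : ∀ b : ↥sphereOffCore, Joined b (belt baseAngle) := fun b => by
    have h1 : Joined b (belt (ang b)) := ⟨beltHomotopy.evalAt b⟩
    exact h1.trans ⟨(PathConnectedSpace.somePath (ang b) baseAngle).map belt.continuous⟩
  exact ⟨⟨belt baseAngle⟩, fun x y => (key x).trans (key y).symm⟩

end Homology

/-! ## §3 The design statement -/

/-- **(D-sphere) `Kas_sphereOffCore_homology`** (= registered sub-goal stub
`stub_Kas_sphereOffCore_homology` of `stub_modelsOn_counts`): `S³ ∖ S` is path connected, the model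
longitude dies in it and the model meridian has infinite order. [cite: GompfStipsicz1999, §8.2] -/
theorem Kas_sphereOffCore_homology :
    IsPathConnected (sphereOffCore : Set ↥(beltPiece 3 2)) ∧
    singularHomology.map ℤ ℤ ⟨tubeSeamToSphereOffCore, continuous_tubeSeamToSphereOffCore⟩ 1
        (loopClass ℤ ℤ (1 : ℤ) (loopPath modelLong continuous_modelLong)) = 0 ∧
    ∀ a : ℤ, a • singularHomology.map ℤ ℤ ⟨tubeSeamToSphereOffCore, continuous_tubeSeamToSphereOffCore⟩ 1
        (loopClass ℤ ℤ (1 : ℤ) (loopPath modelMer continuous_modelMer)) = 0 → a = 0 :=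
  ⟨isPathConnected_sphereOffCore, map_loopClass_modelLong_eq_zero, eq_zero_of_zsmul_modelMer_eq_zero⟩


/-- **(D-sphere) registered sub-goal stub `stub_Kas_sphereOffCore_homology`** of
`stub_modelsOn_counts` (design lemma `Kas_sphereOffCore_homology` verbatim). [cite: GompfStipsicz1999, §8.2] -/
theorem stub_Kas_sphereOffCore_homology :
    IsPathConnected (sphereOffCore : Set ↥(Literature.Topology.FourManifolds.beltPiece 3 2)) ∧
    Literature.AlgebraicTopology.SingularHomology.singularHomology.map ℤ ℤ
        ⟨tubeSeamToSphereOffCore, continuous_tubeSeamToSphereOffCore⟩ 1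
        (Literature.AlgebraicTopology.SingularHomology.loopClass ℤ ℤ (1 : ℤ)
          (Literature.Topology.FourManifolds.LefschetzBase.loopPath modelLong continuous_modelLong)) = 0 ∧
    ∀ a : ℤ, a • Literature.AlgebraicTopology.SingularHomology.singularHomology.map ℤ ℤ
        ⟨tubeSeamToSphereOffCore, continuous_tubeSeamToSphereOffCore⟩ 1
        (Literature.AlgebraicTopology.SingularHomology.loopClass ℤ ℤ (1 : ℤ)
          (Literature.Topology.FourManifolds.LefschetzBase.loopPath modelMer continuous_modelMer)) = 0 →
      a = 0 :=
  Kas_sphereOffCore_homology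

end Summit.SmoothPoincare4.SmoothPoincare4.Theorems.AcyclicBisectionExists.ModpBraidOrbits
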